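import Literature.AnabelianGeometry.EtaleTheta.Discharge.Sec5InvariantUnitsOfBiratAction
import Literature.AnabelianGeometry.EtaleTheta.Discharge.Sec5ModelCase
import Mathlib.Tactic.Group

/-!
# [EtTh] Lemma 5.8, arithmetic step: the units "on which `Π^tp_Y` acts via `μ_N(B_N)`" — structure, and the half `(O_K^×)^{1/N} ⊆ (−)` from the birational action alone (p. 331 / PDF p. 105)

Mochizuki, *The étale theta function and its Frobenioid-theoretic manifestations*, Publ. RIMS **45**
(2009) [cite: MochizukiEtTh2009, Lem 5.8 p.331 (PDF p.105)].  abc-iut cell, block F (fact-proving wave),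
seat abc-iut-f-120; FACT-LIST rows **F-0534** (`ThetaFrobenioid.ActsByCyclotome`, [EtTh] Lemma 5.8 p.331),
**F-0535** (`ThetaFrobenioid.ConstantsActByCyclotome`, Lemma 5.8 p.331), **F-0533**
(`ThetaFrobenioid.IdentifiesPiY`, Lemma 5.9 (iv) p.332), **F-1307** (`ThetaFrobenioid.CyclotomicCharacterCompat`,
Lemma 5.8 proof p.331).  PROOF-ONLY companion (no `def`, no `structure`, no instance, no `Prop` fact) of
abc-iut-L2-t4's FROZEN `FrobenioidMonoTheta.lean` / `FrobenioidEnvelopeIso.lean`; nothing landed is edited.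

All four rows are PARAMETRISED predicates over abstract §5 data `𝔉 : ThetaFrobenioid C D` (no landed
`ThetaFrobenioid` is a closed term), so what the kernel can certify about them is (a) their STRUCTURE and
(b) the INSTANCE FORMS consumers bind (FACT-LIST rule R5).  Print (proof of Lemma 5.8, p.331 (PDF p.105)):
"the set of elements of `O^×(B_N)` that normalize the subgroup `E_N ⊆ Aut_C(B_N)` is equal to the set of
elements on which `Π^tp_Y` [i.e., `G_K`, via the natural surjection `Π^tp_Y ↠ G_K`] acts via multiplication
by an element of `μ_N(B_N)`.  But this last set is easily seen to coincide with `(O_K^×)^{1/N}`."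

* **F-0534** (`ActsByCyclotome u`, the predicate "`Π^tp_Y` acts on `u` via multiplication by an element of
  `μ_N(B_N)`"): `1`, every element of `μ_N(B_N)` (`actsByCyclotome_one`, `actsByCyclotome_of_mem_muTorsion`),
  and the units with the property are closed under `·` and `⁻¹` (`actsByCyclotome_mul`,
  `actsByCyclotome_inv`) — the set print calls `(O_K^×)^{1/N}` IS a subgroup of `O^×(B_N)` containing
  `μ_N(B_N)`; and **`actsByCyclotome_of_mem_OKxRootN`**: every element of `(O_K^×)^{1/N}` acts by the
  cyclotome, from "the natural action" of `Aut_C(B_N)` on `O^×(B_N^birat)` (abc-iut-L2-t11's hypothesis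
  structure `BiratAutAction`: constants fixed, `O^×(B_N) ↪ O^×(B_N^birat)` equivariant and injective) ALONE —
  `u^N` is a constant, hence fixed by every conjugation (`conj_eq_of_mem_constEmb_range`), hence `Π^tp_Y`
  fixes `u^N`, which is abc-iut-w4-d095's Kummer criterion `actsByCyclotome_iff_pow_invariant`.
* **F-0535** (`ConstantsActByCyclotome`: "`(O_K^×)^{1/N}` = the units acting via `μ_N(B_N)`", abc-iut-L2-t4's
  named arithmetic input of Lemma 5.8, field `constantsActByCyclotome` of the bundle `Facts`): its `⊆` HALF is
  a theorem of the birational action alone (`okxRootN_subset_actsByCyclotome`); modulo the action the named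
  fact is EQUIVALENT to its `⊇` half (`constantsActByCyclotome_iff_superset`) and to the sharp Kummer-theoretic
  residual "a unit whose `N`-th power is `Π^tp_Y`-invariant has `N`-th power in `K^×`"
  (`constantsActByCyclotome_iff_invariantPowsConstant`) — print: "since `Y` is geometrically connected over
  `K`"; the tree's earlier sufficient input `InvariantUnitsEqConstants` (abc-iut-w4-d095) implies it
  (`invariantPowsConstant_of_invariantUnitsEqConstants`).
* **F-0533** (`IdentifiesPiY T ι`, the dictionary hypothesis "`ι` carries `Π^tp_Y̲` onto `Π^tp_Y`" of the
  Lemma 5.9 (iv) comparison): its subgroup form `Π^tp_Y̲.map ι = Π^tp_Y` (`identifiesPiY_iff_map_eq`) and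
  stability under `Π^tp_Y`-preserving reparametrisations of the target (`IdentifiesPiY.trans`); the named
  instance (`ι = id` for §5 data built over `T`) is abc-iut-L2-t4's `identifiesPiY_ofThetaEnvData`.
* **F-1307** (`CyclotomicCharacterCompat T ι m`, "`Π^tp_Y` acts on `μ_N(B_N)` via the cyclotomic
  character"): its one-variable form through abc-iut-L2-t11's `conjMu` (`cyclotomicCharacterCompat_iff_conjMu`)
  and the level-`1` instance (`cyclotomicCharacterCompat_of_subsingleton`: for `N = 1` the cyclotome is
  trivial and the compatibility is automatic); the general instance is abc-iut-L2-t11's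
  `cyclotomicCharacterCompatX_of_galoisDictionary` + `CyclotomicCharacterCompatX.toY`.

HONEST FRAMING: kernel-checked structure lemmas and implications between typed statements about the §5
data; [EtTh] is a refereed paper; typed ≠ proved for the genuine data; a FACT row is an assumption label,
not an endorsement; nothing here bears on [IUTchIII] Cor. 3.12 or takes a side.
-/

namespace Literature.AnabelianGeometry.EtaleTheta

open CategoryTheory

universe w v v' u u'

namespace ThetaFrobenioid

variable {C : Type u} [Category.{v} C] {D : Type u'} [Category.{v'} D] (𝔉 : ThetaFrobenioid.{w} C D)

/-! ### F-0534: structure of "acts via multiplication by an element of `μ_N(B_N)`" -/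

/-- The identity acts by the cyclotome (all commutators are `1 ∈ μ_N(B_N)`).
[cite: MochizukiEtTh2009, Lem 5.8 proof p.331 (PDF p.105)] -/
theorem actsByCyclotome_one : 𝔉.ActsByCyclotome 1 := by
  intro y _
  simp only [mul_one, mul_inv_cancel, inv_one]
  exact (𝔉.muTorsion 𝔉.BN 𝔉.N).one_mem

/-- Every element of `μ_N(B_N)` acts by the cyclotome (`μ_N(B_N)` is normal in `Aut_C(B_N)`).
[cite: MochizukiEtTh2009, Lem 5.8 proof p.331 (PDF p.105)] -/
theorem actsByCyclotome_of_mem_muTorsion {u : Aut 𝔉.BN} (hu : u ∈ 𝔉.muTorsion 𝔉.BN 𝔉.N) :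
    𝔉.ActsByCyclotome u := by
  intro y _
  exact (𝔉.muTorsion 𝔉.BN 𝔉.N).mul_mem ((𝔉.muTorsion_normal 𝔉.BN 𝔉.N).conj_mem u hu _)
    ((𝔉.muTorsion 𝔉.BN 𝔉.N).inv_mem hu)

/-- The elements acting by the cyclotome are closed under multiplication by a unit acting by the
cyclotome (`O^×(B_N)` is abelian and contains `μ_N(B_N)`: `c(uv)c⁻¹(uv)⁻¹ = (cuc⁻¹u⁻¹)·(cvc⁻¹v⁻¹)` for
`u ∈ O^×(B_N)`).  [cite: MochizukiEtTh2009, Lem 5.8 proof p.331 (PDF p.105)] -/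
theorem actsByCyclotome_mul {u v : Aut 𝔉.BN} (hu : u ∈ 𝔉.units 𝔉.BN)
    (hau : 𝔉.ActsByCyclotome u) (hav : 𝔉.ActsByCyclotome v) : 𝔉.ActsByCyclotome (u * v) := by
  intro y hy
  set c := 𝔉.sgpCap y
  have hcv : c * v * c⁻¹ * v⁻¹ ∈ 𝔉.muTorsion 𝔉.BN 𝔉.N := hav y hy
  have hcomm : c * v * c⁻¹ * v⁻¹ * u⁻¹ = u⁻¹ * (c * v * c⁻¹ * v⁻¹) :=
    setLike_mul_comm (s := 𝔉.units 𝔉.BN) (𝔉.muTorsion_le_units 𝔉.BN 𝔉.N hcv)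
      ((𝔉.units 𝔉.BN).inv_mem hu)
  have key : c * (u * v) * c⁻¹ * (u * v)⁻¹ = (c * u * c⁻¹ * u⁻¹) * (c * v * c⁻¹ * v⁻¹) := by
    calc c * (u * v) * c⁻¹ * (u * v)⁻¹ = (c * u * c⁻¹) * (c * v * c⁻¹ * v⁻¹ * u⁻¹) := by group
      _ = (c * u * c⁻¹) * (u⁻¹ * (c * v * c⁻¹ * v⁻¹)) := by rw [hcomm]
      _ = (c * u * c⁻¹ * u⁻¹) * (c * v * c⁻¹ * v⁻¹) := by group
  rw [key]
  exact (𝔉.muTorsion 𝔉.BN 𝔉.N).mul_mem (hau y hy) hcv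

/-- The units acting by the cyclotome are closed under inversion
(`cu⁻¹c⁻¹u = u⁻¹·(cuc⁻¹u⁻¹)⁻¹·u`, and `μ_N(B_N)` is normal).
[cite: MochizukiEtTh2009, Lem 5.8 proof p.331 (PDF p.105)] -/
theorem actsByCyclotome_inv {u : Aut 𝔉.BN} (hau : 𝔉.ActsByCyclotome u) : 𝔉.ActsByCyclotome u⁻¹ := by
  intro y hy
  set c := 𝔉.sgpCap y
  have key : c * u⁻¹ * c⁻¹ * u⁻¹⁻¹ = u⁻¹ * (c * u * c⁻¹ * u⁻¹)⁻¹ * u⁻¹⁻¹ := by group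
  rw [key]
  exact (𝔉.muTorsion_normal 𝔉.BN 𝔉.N).conj_mem _ ((𝔉.muTorsion 𝔉.BN 𝔉.N).inv_mem (hau y hy)) u⁻¹

/-- **F-0534 at the printed instance, from the birational action alone: every element of `(O_K^×)^{1/N}`
acts via multiplication by an element of `μ_N(B_N)`.**  For `u ∈ (O_K^×)^{1/N}` the power `u^N` is a
constant, hence fixed by every `Aut_C(B_N)`-conjugation (constants are fixed by "the natural action" on
`O^×(B_N^birat)` and `O^×(B_N) ↪ O^×(B_N^birat)` is equivariant and injective), hence `Π^tp_Y` fixes `u^N`,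
which is the Kummer criterion for acting by the cyclotome.  No arithmetic input (`Facts`,
`InvariantUnitsEqConstants`, geometric connectedness) is used.
[cite: MochizukiEtTh2009, Lem 5.8 proof p.331 (PDF p.105)] -/
theorem actsByCyclotome_of_mem_OKxRootN (α : 𝔉.BiratAutAction) {u : Aut 𝔉.BN} (hu : u ∈ 𝔉.OKxRootN) :
    𝔉.ActsByCyclotome u := by
  obtain ⟨v, hv, rfl⟩ := hu
  change 𝔉.ActsByCyclotome (v : Aut 𝔉.BN)
  rw [𝔉.actsByCyclotome_iff_pow_invariant v.2]
  have hvN : 𝔉.unitsToBirat 𝔉.BN (v ^ (𝔉.N : ℕ)) ∈ 𝔉.constEmb.range := by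
    rw [map_pow]
    exact 𝔉.mem_KxRootN.mp hv
  intro y _
  have h := 𝔉.conj_eq_of_mem_constEmb_range α (v ^ (𝔉.N : ℕ)) hvN (𝔉.sgpCap y)
  simpa only [Subgroup.coe_pow] using h

/-! ### F-0535: `ConstantsActByCyclotome` — the `⊆` half is structural, the `⊇` half is the arithmetic residual -/

/-- **F-0535, the `⊆` half of Lemma 5.8's arithmetic step from the birational action alone**:
`(O_K^×)^{1/N} ⊆ {u ∈ O^×(B_N) | Π^tp_Y acts on u via μ_N(B_N)}`.
[cite: MochizukiEtTh2009, Lem 5.8 proof p.331 (PDF p.105)] -/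
theorem okxRootN_subset_actsByCyclotome (α : 𝔉.BiratAutAction) (u : Aut 𝔉.BN) (hu : u ∈ 𝔉.OKxRootN) :
    u ∈ 𝔉.units 𝔉.BN ∧ 𝔉.ActsByCyclotome u :=
  ⟨𝔉.OKxRootN_le_units hu, 𝔉.actsByCyclotome_of_mem_OKxRootN α hu⟩

/-- **F-0535 reduced to its `⊇` half**: given the birational action, the named fact
`ConstantsActByCyclotome` holds iff every unit on which `Π^tp_Y` acts via `μ_N(B_N)` lies in `(O_K^×)^{1/N}`.
[cite: MochizukiEtTh2009, Lem 5.8 proof p.331 (PDF p.105)] -/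
theorem constantsActByCyclotome_iff_superset (α : 𝔉.BiratAutAction) :
    𝔉.ConstantsActByCyclotome ↔
      ∀ u ∈ 𝔉.units 𝔉.BN, 𝔉.ActsByCyclotome u → u ∈ 𝔉.OKxRootN := by
  constructor
  · intro h u hu ha
    exact (h u).mpr ⟨hu, ha⟩
  · intro h u
    exact ⟨𝔉.okxRootN_subset_actsByCyclotome α u, fun hua => h u hua.1 hua.2⟩

/-- **F-0535 reduced to its sharp Kummer-theoretic residual**: given the birational action,
`ConstantsActByCyclotome` holds iff "a unit whose `N`-th power is `Π^tp_Y`-invariant has `N`-th power in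
(the image of) `K^×`" — print: "this last set is easily seen to coincide with `(O_K^×)^{1/N}`" ("since `Y` is
geometrically connected over `K`").  [cite: MochizukiEtTh2009, Lem 5.8 proof p.331 (PDF p.105)] -/
theorem constantsActByCyclotome_iff_invariantPowsConstant (α : 𝔉.BiratAutAction) :
    𝔉.ConstantsActByCyclotome ↔
      ∀ u : 𝔉.units 𝔉.BN,
        (∀ y ∈ 𝔉.imPiY, 𝔉.sgpCap y * (u : Aut 𝔉.BN) ^ (𝔉.N : ℕ) * (𝔉.sgpCap y)⁻¹ =
          (u : Aut 𝔉.BN) ^ (𝔉.N : ℕ)) →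
        𝔉.unitsToBirat 𝔉.BN u ^ (𝔉.N : ℕ) ∈ 𝔉.constEmb.range := by
  rw [𝔉.constantsActByCyclotome_iff_superset α]
  constructor
  · intro h u hfix
    have hmem : (u : Aut 𝔉.BN) ∈ 𝔉.OKxRootN :=
      h u u.2 ((𝔉.actsByCyclotome_iff_pow_invariant u.2).mpr hfix)
    obtain ⟨_, h'⟩ := (mem_OKxRootN_iff (u : Aut 𝔉.BN)).mp hmem
    exact h'
  · intro h u hu ha
    exact (mem_OKxRootN_iff u).mpr
      ⟨hu, h ⟨u, hu⟩ ((𝔉.actsByCyclotome_iff_pow_invariant hu).mp ha)⟩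

/-- The residual of `constantsActByCyclotome_iff_invariantPowsConstant` follows from abc-iut-w4-d095's
earlier sufficient input `InvariantUnitsEqConstants` ("`(O^×(B_N))^{Π^tp_Y} = O_K^×`"), applied to `u^N`.
[cite: MochizukiEtTh2009, Lem 5.8 proof p.331 (PDF p.105)] -/
theorem invariantPowsConstant_of_invariantUnitsEqConstants (h : 𝔉.InvariantUnitsEqConstants)
    (u : 𝔉.units 𝔉.BN)
    (hfix : ∀ y ∈ 𝔉.imPiY, 𝔉.sgpCap y * (u : Aut 𝔉.BN) ^ (𝔉.N : ℕ) * (𝔉.sgpCap y)⁻¹ =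
      (u : Aut 𝔉.BN) ^ (𝔉.N : ℕ)) :
    𝔉.unitsToBirat 𝔉.BN u ^ (𝔉.N : ℕ) ∈ 𝔉.constEmb.range := by
  rw [← map_pow]
  apply (h (u ^ (𝔉.N : ℕ))).mp
  intro y hy
  simpa only [Subgroup.coe_pow] using hfix y hy

/-- Consistency check of the two reductions: abc-iut-L2-t4's route
`constantsActByCyclotome_of_conjFixed` (birational action + the forward half `hgc` of
`InvariantUnitsEqConstants`) factors through the sharp residual.
[cite: MochizukiEtTh2009, Lem 5.8 proof p.331 (PDF p.105)] -/
theorem constantsActByCyclotome_of_invariantPowsConstant (α : 𝔉.BiratAutAction)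
    (h : ∀ u : 𝔉.units 𝔉.BN,
      (∀ y ∈ 𝔉.imPiY, 𝔉.sgpCap y * (u : Aut 𝔉.BN) ^ (𝔉.N : ℕ) * (𝔉.sgpCap y)⁻¹ =
        (u : Aut 𝔉.BN) ^ (𝔉.N : ℕ)) →
      𝔉.unitsToBirat 𝔉.BN u ^ (𝔉.N : ℕ) ∈ 𝔉.constEmb.range) :
    𝔉.ConstantsActByCyclotome :=
  (𝔉.constantsActByCyclotome_iff_invariantPowsConstant α).mpr h

/-! ### F-0533: the dictionary hypothesis `IdentifiesPiY` in subgroup form -/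

/-- **F-0533, subgroup form**: `ι` "carries `Π^tp_Y̲` onto `Π^tp_Y`" iff `ι(Π^tp_Y̲) = Π^tp_Y` as subgroups.
[cite: MochizukiEtTh2009, Lem 5.9 (iv) p.332 (PDF p.106)] -/
theorem identifiesPiY_iff_map_eq (T : ThetaEnvData.{v} 𝔉.N) (ι : 𝔉.PiX ≃* T.PiX) :
    𝔉.IdentifiesPiY T ι ↔ 𝔉.PiY.map ι.toMonoidHom = T.PiY := by
  constructor
  · intro h
    ext x
    rw [Subgroup.mem_map_equiv, h (ι.symm x), MulEquiv.apply_symm_apply]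
  · intro h y
    rw [← h, Subgroup.mem_map_equiv, MulEquiv.symm_apply_apply]

/-- `IdentifiesPiY` is stable under composing `ι` with any automorphism of `Π^tp_X` preserving `Π^tp_Y`
(the comparison of Lemma 5.9 (iv) is insensitive to such reparametrisations of the §2 side).
[cite: MochizukiEtTh2009, Lem 5.9 (iv) p.332 (PDF p.106)] -/
theorem IdentifiesPiY.trans {T : ThetaEnvData.{v} 𝔉.N} {ι : 𝔉.PiX ≃* T.PiX} (h : 𝔉.IdentifiesPiY T ι)
    (φ : T.PiX ≃* T.PiX) (hφ : ∀ p : T.PiX, p ∈ T.PiY ↔ φ p ∈ T.PiY) :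
    𝔉.IdentifiesPiY T (ι.trans φ) :=
  fun y => (h y).trans (hφ (ι y))

/-! ### F-1307: `CyclotomicCharacterCompat` in one-variable form; the level-`1` instance -/

/-- **F-1307, one-variable form**: "`Π^tp_Y` acts on `μ_N(B_N)` via the cyclotomic character" iff for every
`y ∈ Π^tp_Y̲` and `u ∈ μ_N(B_N)`, `m(s^⊓-gp_N(ρ y) ∘ u ∘ s^⊓-gp_N(ρ y)⁻¹) = χ(aug(ι y))(m u)` (the conjugate
packaged by abc-iut-L2-t11's `conjMu`).  [cite: MochizukiEtTh2009, Lem 5.8 proof p.331 (PDF p.105)] -/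
theorem cyclotomicCharacterCompat_iff_conjMu (T : ThetaEnvData.{v} 𝔉.N) (ι : 𝔉.PiX ≃* T.PiX)
    (m : 𝔉.muTorsion 𝔉.BN 𝔉.N ≃* T.mu) :
    𝔉.CyclotomicCharacterCompat T ι m ↔
      ∀ y : 𝔉.PiX, y ∈ 𝔉.PiY → ∀ u : 𝔉.muTorsion 𝔉.BN 𝔉.N,
        m (BiratAutAction.conjMu (𝔉.sgpCap (𝔉.ρ y)) u) = T.chi (T.aug (ι y)) (m u) := by
  constructor
  · intro h y hy u
    exact h y hy u _ rfl
  · intro h y hy u u' hu'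
    have hc : u' = BiratAutAction.conjMu (𝔉.sgpCap (𝔉.ρ y)) u := Subtype.ext hu'
    rw [hc]
    exact h y hy u

/-- **F-1307 at level `N = 1`** (more generally whenever the cyclotome `μ_N` of the §2 data is trivial): the
compatibility holds for every `ι` and `m`.  [cite: MochizukiEtTh2009, Lem 5.8 proof p.331 (PDF p.105)] -/
theorem cyclotomicCharacterCompat_of_subsingleton (T : ThetaEnvData.{v} 𝔉.N) [Subsingleton T.mu]
    (ι : 𝔉.PiX ≃* T.PiX) (m : 𝔉.muTorsion 𝔉.BN 𝔉.N ≃* T.mu) :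
    𝔉.CyclotomicCharacterCompat T ι m :=
  fun _ _ _ _ _ => Subsingleton.elim _ _

/-- The cyclotome of level-`1` §2 data is trivial (`|μ_N| = N = 1`), so F-1307 holds at `N = 1`
unconditionally.  [cite: MochizukiEtTh2009, Def 2.13 p.273 (PDF p.47)] -/
theorem cyclotomicCharacterCompat_of_N_eq_one (hN : (𝔉.N : ℕ) = 1) (T : ThetaEnvData.{v} 𝔉.N)
    (ι : 𝔉.PiX ≃* T.PiX) (m : 𝔉.muTorsion 𝔉.BN 𝔉.N ≃* T.mu) :
    𝔉.CyclotomicCharacterCompat T ι m := by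
  haveI : Subsingleton T.mu := Fintype.card_le_one_iff_subsingleton.mp (by rw [T.card_mu, hN])
  exact 𝔉.cyclotomicCharacterCompat_of_subsingleton T ι m

end ThetaFrobenioid

end Literature.AnabelianGeometry.EtaleTheta
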